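import Mathlib
import HarnessLib
import Literature.Analysis.FunctionSpaces.BesselIGeneratingFunction
import Summits.Ventures.LatticeQCDFlow.Scaling.WilsonActionNontrivial
import Summits.Ventures.LatticeQCDFlow.Scaling.U1IdentityFlowVolumeLaw

/-!
# LatticeQCDFlow / Scaling — STRICT coupling monotonicity of the untrained sampler: `log Z` is
# strictly convex for every non-degenerate tilt family, so `Z(β/2)²/Z(β)` and `Z(β)²/Z(2β)`
# decrease STRICTLY on `[0, ∞)` — Wilson theories with a non-maximal trace, U(1) plaquettes

HONEST FRAMING: exact (Metropolis-corrected) sampling algorithms for lattice gauge theory;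
figures of merit are autocorrelation/cost numbers at stated couplings and volumes; no
continuum-physics claim.

Venture `LatticeQCDFlow` (cell pub-lqcd), topic `Scaling`; FANOUT row 3 (`s0-u1-a`, S0-B
implementation A, GEN-16).  NEW WORK of the cell (elementary), not a published result; NO definition
is introduced.  Strict sequel of row 3's `Scaling/IdentityFlowCouplingMonotone` (GEN-16; kept
import-free of it so that both elaborate independently): there the Bhattacharyya ceiling
`Z(β/2)²/Z(β)` and the ESS `Z(β)²/Z(2β)` of the untrained exact sampler of a tilt family
`e^{βT}μ/Z(β)`, `Z = mgf T μ`, were shown NON-increasing on `[0, ∞)` from the convexity of `log Z`.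
Here `log Z` is shown STRICTLY convex as soon as `T` is not `μ`-a.e. constant — by Mathlib's
analytic cumulant generating function: `(log Z)'' (v) = ∫ (T − (log Z)'(v))² e^{vT} dμ / Z(v)`
(`ProbabilityTheory.iteratedDeriv_two_cgf_eq_integral`) is the variance of `T` under the tilted law,
positive unless `T` is a.e. constant — and strict secant monotonicity then makes both ratios STRICTLY
decreasing.  Consequently (value-free; every volume):

* §1 `slope_lt_slope_of_strictConvexOn`; **`strictAntiOn_two_mul_half_sub`** (`β ↦ 2f(β/2) − f(β)`
  on `[0, ∞)`) and the doubled form `strictAntiOn_two_mul_sub_double`, for strictly convex `f`;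
* §2 **`strictConvexOn_log_mgf`** — `log Z` is strictly convex on `ℝ` for every `μ ≠ 0` and every
  `T` with all exponential moments that is not a.e. constant; hence **`mgf_half_sq_div_strictAntiOn`**
  and **`mgf_sq_div_double_strictAntiOn`** on `[0, ∞)` (the mirror statements on `(−∞, 0]` follow
  by `T ↦ −T` and are not spelled out);
* §3 WILSON, product Haar: `wilsonAction_not_ae_const` (an action that is not identically zero is not
  a.e. constant: `{S ≠ c}` is open and non-empty, product Haar charges open sets — GEN-14's argument);
  **`wilsonIdentityFlow_bhattSq_strictAntiOn`**, **`wilsonIdentityFlow_essFrac_strictAntiOn`**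
  (`Z = (partitionFunction ρ ·).toReal`; hypotheses: continuous `ρ`, `∃ U₀, S U₀ ≠ 0`), and the
  discharged forms `…_of_trace` (`L ≥ 2`, two directions, a non-maximal trace value — row 3's
  `exists_wilsonAction_ne_zero`), **`u1IdentityFlow_torus_essFrac_strictAntiOn`** (U(1), unconditional);
* §4 U(1) PLAQUETTES: `cos` is not a.e. constant on `(0, 2π]`, so **`strictConvexOn_log_besselI_zero`**
  (`log I₀` is strictly convex on `ℝ`), **`strictAntiOn_besselI_half_sq_div`** (`I₀(β/2)²/I₀(β)`
  strictly decreasing on `[0, ∞)`, strictly increasing on `(−∞, 0]` by parity),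
  **`strictAntiOn_besselI_sq_div_double`** (`I₀(β)²/I₀(2β)` likewise), and
  **`u1IdentityFlow_essFrac_strictAntiOn`** — the exact ESS `(I₀(β)²/I₀(2β))^V` of row 3's untrained
  U(1) sampler (`u1IdentityFlow_essFrac`, `V ≥ 1` plaquettes) is STRICTLY decreasing in `|β|`.

Reading (value-free; no number of ours is computed or implied): for the untrained exact sampler of
any Wilson theory whose action is not identically zero, and of the factorised U(1) model, a larger
`|β|` gives a STRICTLY smaller ESS and a strictly smaller Bhattacharyya ceiling of the acceptance.
NOT CLAIMED: strict monotonicity of the acceptance itself; the SU(2) class-angle law; any value at the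
cell's `(β, L)`; nothing re-scored, SEALED.md untouched.
-/

noncomputable section

namespace Summit.Ventures.LatticeQCDFlow.Theory2

open MeasureTheory Real Set ProbabilityTheory
open Literature.Analysis.FunctionSpaces (besselI besselI_zero_pos besselI_neg_arg)
open Literature.MathematicalPhysics.QuantumLattice (u1Rep continuous_u1Rep)
open Summit.Ventures.LatticeQCDFlow.Scoring (onePlaquetteZ onePlaquetteZ_pos onePlaquetteZ_eq_besselI)

/-! ## §1 Strict second differences of a strictly convex function -/

section Convex

variable {s : Set ℝ} {f : ℝ → ℝ}

/-- **Strict secant comparison**: for a strictly convex `f` and `a < b`, `c < d` in `s` with `a ≤ c`,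
`b ≤ d` and (`a < c` or `b < d`): `(f b − f a)/(b − a) < (f d − f c)/(d − c)`. [folklore] -/
theorem slope_lt_slope_of_strictConvexOn (hf : StrictConvexOn ℝ s f) {a b c d : ℝ} (ha : a ∈ s)
    (hb : b ∈ s) (hc : c ∈ s) (hd : d ∈ s) (hab : a < b) (hcd : c < d) (hac : a ≤ c) (hbd : b ≤ d)
    (hne : a < c ∨ b < d) :
    (f b - f a) / (b - a) < (f d - f c) / (d - c) := by
  have had : a < d := lt_of_lt_of_le hab hbd
  have e1 : (f a - f d) / (a - d) = (f d - f a) / (d - a) := by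
    rw [← neg_div_neg_eq, neg_sub, neg_sub]
  have e2 : (f c - f d) / (c - d) = (f d - f c) / (d - c) := by
    rw [← neg_div_neg_eq, neg_sub, neg_sub]
  rcases hne with hac' | hbd'
  · have h1 : (f b - f a) / (b - a) ≤ (f d - f a) / (d - a) :=
      hf.convexOn.secant_mono ha hb hd hab.ne' had.ne' hbd
    have h2 : (f a - f d) / (a - d) < (f c - f d) / (c - d) :=
      hf.secant_strict_mono hd ha hc had.ne hcd.ne hac'
    rw [e1, e2] at h2
    exact lt_of_le_of_lt h1 h2
  · have h1 : (f b - f a) / (b - a) < (f d - f a) / (d - a) :=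
      hf.secant_strict_mono ha hb hd hab.ne' had.ne' hbd'
    have h2 : (f a - f d) / (a - d) ≤ (f c - f d) / (c - d) :=
      hf.convexOn.secant_mono hd ha hc had.ne hcd.ne hac
    rw [e1, e2] at h2
    exact lt_of_lt_of_le h1 h2

/-- **`β ↦ 2f(β/2) − f(β)` is STRICTLY decreasing on `[0, ∞)`** for `f` strictly convex there.
[ours] -/
theorem strictAntiOn_two_mul_half_sub (hf : StrictConvexOn ℝ (Ici 0) f) :
    StrictAntiOn (fun β => 2 * f (β / 2) - f β) (Ici (0 : ℝ)) := by
  intro s hs t ht hlt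
  have hs0 : (0 : ℝ) ≤ s := hs
  have key := slope_lt_slope_of_strictConvexOn hf (a := s / 2) (b := t / 2) (c := s) (d := t)
    (mem_Ici.2 (by linarith)) (mem_Ici.2 (by linarith)) hs ht (by linarith) hlt
    (by linarith) (by linarith) (Or.inr (by linarith))
  have hba : 0 < t - s := sub_pos.2 hlt
  have h' : (f (t / 2) - f (s / 2)) * (t - s) < (f t - f s) * (t / 2 - s / 2) := by
    rwa [div_lt_div_iff₀ (by linarith) hba] at key
  show 2 * f (t / 2) - f t < 2 * f (s / 2) - f s
  nlinarith [h', hba]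

/-- Doubled form: `β ↦ 2f(β) − f(2β)` is strictly decreasing on `[0, ∞)`. [ours] -/
theorem strictAntiOn_two_mul_sub_double (hf : StrictConvexOn ℝ (Ici 0) f) :
    StrictAntiOn (fun β => 2 * f β - f (2 * β)) (Ici (0 : ℝ)) := by
  intro s hs t ht hlt
  have h := strictAntiOn_two_mul_half_sub hf (a := 2 * s) (b := 2 * t)
    (mem_Ici.2 (by linarith [mem_Ici.1 hs])) (mem_Ici.2 (by linarith [mem_Ici.1 ht])) (by linarith)
  simpa [mul_div_cancel_left₀ _ (two_ne_zero' ℝ)] using h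

/-- Strict transfer through `exp`: with `F > 0`, strict antitonicity of `2 log F(β/2) − log F(β)`
(resp. of `2 log F(β) − log F(2β)`) gives strict antitonicity of `F(β/2)²/F(β)` (resp. of
`F(β)²/F(2β)`). [folklore] -/
theorem strict_transfer_of_log {F : ℝ → ℝ} {S : Set ℝ} (hF : ∀ β, 0 < F β) :
    (StrictAntiOn (fun β => 2 * Real.log (F (β / 2)) - Real.log (F β)) S →
      StrictAntiOn (fun β => F (β / 2) ^ 2 / F β) S) ∧
    (StrictAntiOn (fun β => 2 * Real.log (F β) - Real.log (F (2 * β))) S →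
      StrictAntiOn (fun β => F β ^ 2 / F (2 * β)) S) := by
  have e : ∀ a b : ℝ, Real.exp (2 * Real.log (F a) - Real.log (F b)) = F a ^ 2 / F b := by
    intro a b
    rw [show (2 : ℝ) * Real.log (F a) = Real.log (F a ^ 2) by rw [Real.log_pow]; norm_num,
      Real.exp_sub, Real.exp_log (pow_pos (hF a) 2), Real.exp_log (hF b)]
  refine ⟨fun h s hs t ht hst => ?_, fun h s hs t ht hst => ?_⟩ <;>
    simpa only [e] using Real.exp_lt_exp.2 (h hs ht hst)

end Convex

/-! ## §2 Strict convexity of `log Z` for a non-degenerate tilt family -/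

section Tilt

variable {Ω : Type*} [MeasurableSpace Ω] {μ : Measure Ω} [NeZero μ] {T : Ω → ℝ}

/-- **`log Z = log ∘ mgf T μ` is STRICTLY convex on `ℝ`** when all exponential moments exist and `T`
is not `μ`-a.e. constant: its second derivative at `v` is the variance of `T` under the `v`-tilted
law (Mathlib `iteratedDeriv_two_cgf_eq_integral`), which is positive. [ours] -/
theorem strictConvexOn_log_mgf (hint : ∀ t, Integrable (fun ω => Real.exp (t * T ω)) μ)
    (hT : ∀ c : ℝ, ¬ (T =ᵐ[μ] fun _ => c)) :
    StrictConvexOn ℝ univ (fun t => Real.log (mgf T μ t)) := by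
  have hmem : ∀ v : ℝ, v ∈ interior (integrableExpSet T μ) := fun v => by
    rw [show integrableExpSet T μ = univ from eq_univ_of_forall hint, interior_univ]; trivial
  have hpos : ∀ t, 0 < mgf T μ t := fun t => mgf_pos' (NeZero.ne μ) (hint t)
  have hTm : AEMeasurable T μ := aemeasurable_of_mem_interior_integrableExpSet (hmem 0)
  show StrictConvexOn ℝ univ (cgf T μ)
  refine StrictMono.strictConvexOn_univ_of_deriv ?_ (strictMono_of_deriv_pos fun v => ?_)
  · exact (continuous_mgf hint).log fun t => (hpos t).ne'
  · rw [show deriv (deriv (cgf T μ)) v = iteratedDeriv 2 (cgf T μ) v by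
      rw [iteratedDeriv_succ, iteratedDeriv_one], iteratedDeriv_two_cgf_eq_integral (hmem v)]
    set c : ℝ := deriv (cgf T μ) v
    refine div_pos ?_ (hpos v)
    -- the integrand `(T − c)² e^{vT}` is non-negative, integrable, with support `{T ≠ c}`
    have hI2 := integrable_pow_mul_exp_of_mem_interior_integrableExpSet (hmem v) 2
    have hI0 := hint v
    have hint' : Integrable (fun ω => (T ω - c) ^ 2 * Real.exp (v * T ω)) μ := by
      refine ((hI2.const_mul 2).add (hI0.const_mul (2 * c ^ 2))).mono' ?_ ?_
      · exact ((hTm.sub_const c).pow_const 2).mul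
          (Real.measurable_exp.comp_aemeasurable (hTm.const_mul v)) |>.aestronglyMeasurable
      · refine ae_of_all _ fun ω => ?_
        simp only [Pi.add_apply, Real.norm_eq_abs]
        rw [abs_of_nonneg (by positivity)]
        nlinarith [mul_nonneg (sq_nonneg (T ω + c)) (Real.exp_pos (v * T ω)).le]
    refine (integral_pos_iff_support_of_nonneg_ae (ae_of_all _ fun ω => by positivity) hint').2 ?_
    have hsub : {ω | ¬ T ω = c} ⊆ Function.support fun ω => (T ω - c) ^ 2 * Real.exp (v * T ω) :=
      fun ω hω => by
        have : (T ω - c) ^ 2 ≠ 0 := pow_ne_zero 2 (sub_ne_zero.2 hω)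
        exact mul_ne_zero this (Real.exp_pos _).ne'
    refine lt_of_lt_of_le (pos_iff_ne_zero.2 fun h0 => hT c ?_) (measure_mono hsub)
    exact ae_iff.2 h0

/-- **`β ↦ Z(β/2)²/Z(β)` is STRICTLY decreasing on `[0, ∞)`** for a non-degenerate tilt family.
[ours] -/
theorem mgf_half_sq_div_strictAntiOn (hint : ∀ t, Integrable (fun ω => Real.exp (t * T ω)) μ)
    (hT : ∀ c : ℝ, ¬ (T =ᵐ[μ] fun _ => c)) :
    StrictAntiOn (fun β => mgf T μ (β / 2) ^ 2 / mgf T μ β) (Ici (0 : ℝ)) :=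
  (strict_transfer_of_log fun β => mgf_pos' (NeZero.ne μ) (hint β)).1
    (strictAntiOn_two_mul_half_sub
      ((strictConvexOn_log_mgf hint hT).subset (subset_univ _) (convex_Ici 0)))

/-- **`β ↦ Z(β)²/Z(2β)` is STRICTLY decreasing on `[0, ∞)`.** [ours] -/
theorem mgf_sq_div_double_strictAntiOn (hint : ∀ t, Integrable (fun ω => Real.exp (t * T ω)) μ)
    (hT : ∀ c : ℝ, ¬ (T =ᵐ[μ] fun _ => c)) :
    StrictAntiOn (fun β => mgf T μ β ^ 2 / mgf T μ (2 * β)) (Ici (0 : ℝ)) :=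
  (strict_transfer_of_log fun β => mgf_pos' (NeZero.ne μ) (hint β)).2
    (strictAntiOn_two_mul_sub_double
      ((strictConvexOn_log_mgf hint hT).subset (subset_univ _) (convex_Ici 0)))

end Tilt

/-! ## §3 Wilson lattice gauge theory under product Haar -/

section Wilson

open Literature.MathematicalPhysics.QuantumFieldTheory

variable {d L N : ℕ} [NeZero L] {G : Type*} [Group G] [TopologicalSpace G] [IsTopologicalGroup G]
  [CompactSpace G] [MeasurableSpace G] [BorelSpace G] (ρ : G →* Matrix (Fin N) (Fin N) ℂ)

/-- **A Wilson action that is not identically zero is not a.e. constant under product Haar**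
(`{S ≠ c}` is open, non-empty — `S(1) = 0` — and product Haar charges open sets). [ours] -/
theorem wilsonAction_not_ae_const (hρ : Continuous ρ) (hS : ∃ U₀ : GaugeConfig d L G, wilsonAction ρ U₀ ≠ 0)
    (c : ℝ) :
    ¬ ((fun U => -wilsonAction ρ U)
        =ᵐ[Measure.pi fun _ : Edge d L => haarProbability G] fun _ => c) := by
  haveI : (haarProbability G).IsOpenPosMeasure := by unfold haarProbability; infer_instance
  intro h
  obtain ⟨U₀, hU₀⟩ := hS
  have hopen : IsOpen {U : GaugeConfig d L G | -wilsonAction ρ U ≠ c} :=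
    isOpen_ne_fun (continuous_wilsonAction_of_continuous ρ hρ).neg continuous_const
  have hne : ({U : GaugeConfig d L G | -wilsonAction ρ U ≠ c}).Nonempty := by
    by_cases hc0 : c = 0
    · exact ⟨U₀, by rw [Set.mem_setOf_eq, hc0, neg_ne_zero]; exact hU₀⟩
    · exact ⟨1, by rw [Set.mem_setOf_eq, wilsonAction_one_eq_zero, neg_zero]; exact Ne.symm hc0⟩
  exact (hopen.measure_pos _ hne).ne' (ae_iff.1 h)

/-- `Z(β) = (partitionFunction ρ β).toReal` is `mgf (−S) Haar^{⊗E} β`. [folklore] -/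
theorem partitionFunction_toReal_eq_mgf (hρ : Continuous ρ) (β : ℝ) :
    (partitionFunction (d := d) (L := L) ρ β).toReal
      = mgf (fun U => -wilsonAction ρ U) (Measure.pi fun _ : Edge d L => haarProbability G) β := by
  rw [partitionFunction_toReal_eq_integral ρ hρ]
  simp only [mgf, neg_mul, mul_neg]

/-- All exponential moments of `−S` exist under product Haar. [folklore] -/
theorem integrable_exp_mul_neg_wilsonAction_haar (hρ : Continuous ρ) (t : ℝ) :
    Integrable (fun U : GaugeConfig d L G => Real.exp (t * -wilsonAction ρ U))
      (Measure.pi fun _ : Edge d L => haarProbability G) := by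
  simpa only [neg_mul, mul_neg] using integrable_exp_mul_wilsonAction ρ hρ (-t)
    (Measure.pi fun _ : Edge d L => haarProbability G)

/-- **The acceptance ceiling `Z(β/2)²/Z(β)` of the untrained sampler is STRICTLY decreasing on
`[0, ∞)`** for every Wilson theory whose action is not identically zero (`Z = partitionFunction`).
[ours] -/
theorem wilsonIdentityFlow_bhattSq_strictAntiOn (hρ : Continuous ρ)
    (hS : ∃ U₀ : GaugeConfig d L G, wilsonAction ρ U₀ ≠ 0) :
    StrictAntiOn (fun β => (partitionFunction (d := d) (L := L) ρ (β / 2)).toReal ^ 2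
        / (partitionFunction (d := d) (L := L) ρ β).toReal) (Ici (0 : ℝ)) := by
  simp_rw [partitionFunction_toReal_eq_mgf ρ hρ]
  exact mgf_half_sq_div_strictAntiOn (integrable_exp_mul_neg_wilsonAction_haar ρ hρ)
    (wilsonAction_not_ae_const ρ hρ hS)

/-- **The ESS `Z(β)²/Z(2β)` of the untrained sampler is STRICTLY decreasing on `[0, ∞)`** for every
Wilson theory whose action is not identically zero. [ours] -/
theorem wilsonIdentityFlow_essFrac_strictAntiOn (hρ : Continuous ρ)
    (hS : ∃ U₀ : GaugeConfig d L G, wilsonAction ρ U₀ ≠ 0) :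
    StrictAntiOn (fun β => (partitionFunction (d := d) (L := L) ρ β).toReal ^ 2
        / (partitionFunction (d := d) (L := L) ρ (2 * β)).toReal) (Ici (0 : ℝ)) := by
  simp_rw [partitionFunction_toReal_eq_mgf ρ hρ]
  exact mgf_sq_div_double_strictAntiOn (integrable_exp_mul_neg_wilsonAction_haar ρ hρ)
    (wilsonAction_not_ae_const ρ hρ hS)

/-- Discharged form: `L ≥ 2`, directions `i < j`, a non-maximal trace value ⇒ the acceptance ceiling
is strictly decreasing on `[0, ∞)`. [ours] -/
theorem wilsonIdentityFlow_bhattSq_strictAntiOn_of_trace [Fact (1 < L)] (hρ : Continuous ρ)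
    {i j : Fin d} (hij : i < j) (hg : ∃ g : G, (ρ g).trace.re ≠ N) :
    StrictAntiOn (fun β => (partitionFunction (d := d) (L := L) ρ (β / 2)).toReal ^ 2
        / (partitionFunction (d := d) (L := L) ρ β).toReal) (Ici (0 : ℝ)) :=
  wilsonIdentityFlow_bhattSq_strictAntiOn ρ hρ (exists_wilsonAction_ne_zero ρ hρ hij hg)

/-- Discharged form: the ESS is strictly decreasing on `[0, ∞)`. [ours] -/
theorem wilsonIdentityFlow_essFrac_strictAntiOn_of_trace [Fact (1 < L)] (hρ : Continuous ρ)
    {i j : Fin d} (hij : i < j) (hg : ∃ g : G, (ρ g).trace.re ≠ N) :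
    StrictAntiOn (fun β => (partitionFunction (d := d) (L := L) ρ β).toReal ^ 2
        / (partitionFunction (d := d) (L := L) ρ (2 * β)).toReal) (Ici (0 : ℝ)) :=
  wilsonIdentityFlow_essFrac_strictAntiOn ρ hρ (exists_wilsonAction_ne_zero ρ hρ hij hg)

/-- **U(1), unconditionally**: the untrained sampler's ESS `Z(β)²/Z(2β)` on `(ℤ/L)^d` (`L ≥ 2`,
directions `i < j`) is strictly decreasing in `β ≥ 0`. [ours] -/
theorem u1IdentityFlow_torus_essFrac_strictAntiOn [Fact (1 < L)] {i j : Fin d} (hij : i < j) :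
    StrictAntiOn (fun β => (partitionFunction (d := d) (L := L) u1Rep β).toReal ^ 2
        / (partitionFunction (d := d) (L := L) u1Rep (2 * β)).toReal) (Ici (0 : ℝ)) :=
  wilsonIdentityFlow_essFrac_strictAntiOn_of_trace u1Rep continuous_u1Rep hij
    Lattice.TwoDim.exists_u1_trace_re_ne

end Wilson

/-! ## §4 U(1) plaquettes: `log I₀` is strictly convex -/

section U1

/-- `cos` is not a.e. constant on `(0, 2π]`. [folklore] -/
theorem cos_not_ae_const_Ioc (c : ℝ) :
    ¬ ((fun θ => Real.cos θ) =ᵐ[volume.restrict (Ioc (0 : ℝ) (2 * π))] fun _ => c) := by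
  intro h
  have h' : ∀ᵐ θ ∂(volume : Measure ℝ), θ ∈ Ioc (0 : ℝ) (2 * π) → Real.cos θ = c :=
    (ae_restrict_iff' measurableSet_Ioc).1 h
  have h0 : volume {θ : ℝ | ¬ (θ ∈ Ioc (0 : ℝ) (2 * π) → Real.cos θ = c)} = 0 := ae_iff.1 h'
  -- a point of the open interval where `cos ≠ c`
  obtain ⟨θ₀, hθ₀, hc⟩ : ∃ θ₀ ∈ Ioo (0 : ℝ) (2 * π), Real.cos θ₀ ≠ c := by
    by_cases hc : c = -1
    · refine ⟨π / 2, ⟨by positivity, by linarith [Real.pi_pos]⟩, ?_⟩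
      rw [Real.cos_pi_div_two, hc]; norm_num
    · exact ⟨π, ⟨Real.pi_pos, by linarith [Real.pi_pos]⟩, by rw [Real.cos_pi]; exact Ne.symm hc⟩
  have hopen : IsOpen (Ioo (0 : ℝ) (2 * π) ∩ {θ | Real.cos θ ≠ c}) :=
    isOpen_Ioo.inter (isOpen_ne_fun Real.continuous_cos continuous_const)
  have hpos : 0 < volume (Ioo (0 : ℝ) (2 * π) ∩ {θ | Real.cos θ ≠ c}) :=
    hopen.measure_pos volume ⟨θ₀, hθ₀, hc⟩
  have hsub : Ioo (0 : ℝ) (2 * π) ∩ {θ | Real.cos θ ≠ c}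
      ⊆ {θ : ℝ | ¬ (θ ∈ Ioc (0 : ℝ) (2 * π) → Real.cos θ = c)} :=
    fun θ hθ => by
      simp only [Set.mem_setOf_eq, Classical.not_imp]
      exact ⟨Ioo_subset_Ioc_self hθ.1, hθ.2⟩
  exact (lt_of_lt_of_le hpos (measure_mono hsub)).ne' h0

/-- The Haar-Lebesgue law on `(0, 2π]` is not the zero measure. [folklore] -/
theorem neZero_volume_restrict_Ioc_two_pi : NeZero (volume.restrict (Ioc (0 : ℝ) (2 * π))) :=
  ⟨by
    rw [Ne, Measure.restrict_eq_zero, Real.volume_Ioc]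
    have : (0 : ℝ) < 2 * π - 0 := by linarith [Real.pi_pos]
    exact (ENNReal.ofReal_pos.2 this).ne'⟩

/-- `Z(β) = ∫_{(0,2π]} e^{β cos θ} dθ = mgf cos β` on `(0, 2π]`. [folklore] -/
theorem onePlaquetteZ_eq_mgf (β : ℝ) :
    onePlaquetteZ β = mgf (fun θ => Real.cos θ) (volume.restrict (Ioc (0 : ℝ) (2 * π))) β := by
  rw [← integral_Ioc_exp_mul_cos]; rfl

/-- **`log I₀` is STRICTLY convex on `ℝ`.** [ours] -/
theorem strictConvexOn_log_besselI_zero : StrictConvexOn ℝ univ fun β => Real.log (besselI 0 β) := by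
  haveI := neZero_volume_restrict_Ioc_two_pi
  have h := strictConvexOn_log_mgf (μ := volume.restrict (Ioc (0 : ℝ) (2 * π)))
    (T := fun θ => Real.cos θ) integrableOn_exp_mul_cos cos_not_ae_const_Ioc
  have e : (fun β => Real.log (besselI 0 β)) = fun β =>
      Real.log (mgf (fun θ => Real.cos θ) (volume.restrict (Ioc (0 : ℝ) (2 * π))) β)
        + (-Real.log (2 * π)) := by
    funext β
    rw [← onePlaquetteZ_eq_mgf, onePlaquetteZ_eq_besselI, mul_comm,
      Real.log_mul (besselI_zero_pos β).ne' (by positivity)]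
    ring
  rw [e]
  exact h.add_const _

/-- **`β ↦ I₀(β/2)²/I₀(β)` is STRICTLY decreasing on `[0, ∞)` and STRICTLY increasing on `(−∞, 0]`.**
[ours] -/
theorem strictAntiOn_besselI_half_sq_div :
    StrictAntiOn (fun β : ℝ => besselI 0 (β / 2) ^ 2 / besselI 0 β) (Ici (0 : ℝ)) ∧
    StrictMonoOn (fun β : ℝ => besselI 0 (β / 2) ^ 2 / besselI 0 β) (Iic (0 : ℝ)) := by
  have hA := (strict_transfer_of_log besselI_zero_pos).1 (strictAntiOn_two_mul_half_sub
    (strictConvexOn_log_besselI_zero.subset (subset_univ _) (convex_Ici 0)))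
  refine ⟨hA, fun s hs t ht hlt => ?_⟩
  have h := hA (a := -t) (b := -s) (mem_Ici.2 (neg_nonneg.2 (mem_Iic.1 ht)))
    (mem_Ici.2 (neg_nonneg.2 (mem_Iic.1 hs))) (neg_lt_neg hlt)
  simp only [neg_div, besselI_neg_arg, pow_zero, one_mul] at h
  exact h

/-- **`β ↦ I₀(β)²/I₀(2β)` is STRICTLY decreasing on `[0, ∞)` and STRICTLY increasing on `(−∞, 0]`.**
[ours] -/
theorem strictAntiOn_besselI_sq_div_double :
    StrictAntiOn (fun β : ℝ => besselI 0 β ^ 2 / besselI 0 (2 * β)) (Ici (0 : ℝ)) ∧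
    StrictMonoOn (fun β : ℝ => besselI 0 β ^ 2 / besselI 0 (2 * β)) (Iic (0 : ℝ)) := by
  have hA := (strict_transfer_of_log besselI_zero_pos).2 (strictAntiOn_two_mul_sub_double
    (strictConvexOn_log_besselI_zero.subset (subset_univ _) (convex_Ici 0)))
  refine ⟨hA, fun s hs t ht hlt => ?_⟩
  have h := hA (a := -t) (b := -s) (mem_Ici.2 (neg_nonneg.2 (mem_Iic.1 ht)))
    (mem_Ici.2 (neg_nonneg.2 (mem_Iic.1 hs))) (neg_lt_neg hlt)
  simp only [mul_neg, besselI_neg_arg, pow_zero, one_mul] at h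
  exact h

variable {ι : Type*} [Fintype ι] [Nonempty ι]

/-- **THE EXACT ESS OF THE UNTRAINED U(1) SAMPLER IS STRICTLY DECREASING IN `|β|`**: row 3's
`u1IdentityFlow_essFrac` (`ESS_V = (I₀(β)²/I₀(2β))^V`, `V = card ι ≥ 1`) is strictly antitone on
`[0, ∞)` and strictly monotone on `(−∞, 0]`. [ours] -/
theorem u1IdentityFlow_essFrac_strictAntiOn :
    StrictAntiOn (fun β : ℝ =>
      (∫ x, ∏ i : ι, Real.exp (β * Real.cos (x i)) / onePlaquetteZ β
          ∂(Measure.pi fun _ : ι => volume.restrict (Ioc (0 : ℝ) (2 * π)))) ^ 2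
        / ∫ x, (∏ i : ι, Real.exp (β * Real.cos (x i)) / onePlaquetteZ β) ^ 2
            / ∏ _i : ι, (1 / (2 * π) : ℝ)
          ∂(Measure.pi fun _ : ι => volume.restrict (Ioc (0 : ℝ) (2 * π)))) (Ici (0 : ℝ)) ∧
    StrictMonoOn (fun β : ℝ =>
      (∫ x, ∏ i : ι, Real.exp (β * Real.cos (x i)) / onePlaquetteZ β
          ∂(Measure.pi fun _ : ι => volume.restrict (Ioc (0 : ℝ) (2 * π)))) ^ 2
        / ∫ x, (∏ i : ι, Real.exp (β * Real.cos (x i)) / onePlaquetteZ β) ^ 2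
            / ∏ _i : ι, (1 / (2 * π) : ℝ)
          ∂(Measure.pi fun _ : ι => volume.restrict (Ioc (0 : ℝ) (2 * π)))) (Iic (0 : ℝ)) := by
  simp_rw [u1IdentityFlow_essFrac (ι := ι)]
  have hV : Fintype.card ι ≠ 0 := Fintype.card_ne_zero
  have h0 : ∀ β : ℝ, 0 ≤ besselI 0 β ^ 2 / besselI 0 (2 * β) := fun β =>
    div_nonneg (sq_nonneg _) (besselI_zero_pos _).le
  exact ⟨fun s hs t ht hlt => pow_lt_pow_left₀ (strictAntiOn_besselI_sq_div_double.1 hs ht hlt)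
      (h0 _) hV,
    fun s hs t ht hlt => pow_lt_pow_left₀ (strictAntiOn_besselI_sq_div_double.2 hs ht hlt)
      (h0 _) hV⟩

end U1

end Summit.Ventures.LatticeQCDFlow.Theory2

end
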